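import Literature.Topology.FourManifolds.SphereSurgeryOrientation
import Literature.Topology.FourManifolds.ClosedModelRelOrientation
import Literature.Topology.FourManifolds.ClosedModelPuncturedCohomology
import Literature.Topology.FourManifolds.ClosedModelPieces
import Literature.Topology.FourManifolds.SphereSurgeryHomology
import Literature.AlgebraicTopology.SingularHomology.OnePointCollapse
import Literature.AlgebraicTopology.SingularHomology.CohomologyClopenPieces
import Literature.AlgebraicTopology.SingularHomology.CohomologyHomotopyInvariance
import Literature.AlgebraicTopology.SingularHomology.SuspensionIsomorphism
import Literature.AlgebraicTopology.SingularHomology.UniversalCoefficientsFree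
import Literature.AlgebraicTopology.SingularHomology.SphereHomology
import Literature.AlgebraicTopology.SingularHomology.ExcisionMayerVietorisProofs
import HarnessLib

/-!
# The two ends of the closed models before and after a surgery: tube, handle and cone

Topic `Literature/Topology/FourManifolds` (fact seat of
`Literature.Topology.FourManifolds.HomotopySphere.exists_highlyConnected_of_mem_signatureSet`,
brick B6d).  M. Kervaire, J. Milnor, *Groups of homotopy spheres I*, Ann. of Math. 77 (1963),
§5 (Lemma 5.2–5.6) and A. Kosinski, *Differential Manifolds* (1993), X.1: the effect of a surgery
`χ(W, φ)` on an interior framed sphere `φ : Sᵏ × Dˡ⁺¹ ↪ W` is concentrated in the tube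
`T = φ(Sᵏ × Bˡ⁺¹) ≃ Sᵏ` of `W` and the handle `T' = D^{k+1} × Sˡ ≃ Sˡ` of `χ`, the two manifolds
having the common piece `W ∖ S = χ ∖ S'`.  On the closed models `Ŵ = W ∪ cone(bW)`,
`χ̂ = χ ∪ cone(bχ)` (Kervaire–Milnor, footnote pp. 528–529) one also has to keep away from the
cone points: this file fixes a compact part `K₀` of the common open piece
`U = (W ∖ ∂W) ∖ S` — the points off the open unit tube and off a thin collar of the boundary —
and computes the complements of its images:

* `Ŵ ∖ q(K₀) = T̂ ⊔ N` with `T̂ ≅ Sᵏ × Bˡ⁺¹ ≃ Sᵏ` the open tube and `N = N_ε` the cone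
  neighbourhood of `∞` (contractible, `ClosedModelHomology.lean`)
  (`compl_image_boundaryCollapse_awaySet`, `tubeHat_inter_coneNhd_eq_empty`,
  `nonempty_tubeHat_homeomorph`, `modelTubeHomotopyEquiv`);
* `χ̂ ∖ q'(inl K₀) = T̂' ⊔ N'` with `T̂' ≅ B^{k+1} × Sˡ ≃ Sˡ` the open handle and
  `N' = {∞} ∪ (inl C_ε)°` the cone neighbourhood of `∞` over the thin collar `inl C_ε` of `∂χ`
  (`compl_image_boundaryCollapse_awaySet_P`, `handleHat_inter_coneP_eq_empty`,
  `nonempty_handleHat_homeomorph`, `ballProdSphereHomotopyEquiv`, `isOpen_coneP`);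

and deduces the integral cohomology of the tube and the handle in degrees `≥ 2`:
`Hʲ(T̂; ℤ) = 0` for `2 ≤ j ≠ k`, `Hʲ(T̂'; ℤ) = 0` for `2 ≤ j ≠ l` (`Hʲ(Sᴺ; ℤ) = 0` for
`2 ≤ j ≠ N` by the universal coefficient theorem with free `H_{j-1}`,
`isZero_singularCohomology_sphere_int`), and `Hʲ(N; ℤ) = 0` for `j ≠ 0`.  (That `N' ≅ N` — so
that `Hʲ(N'; ℤ) = 0` too — is proved with the collapses onto `Z = U⁺` in the signature file.)
The thin collar is chosen off the closed tube (`exists_collarBelow_disjoint`: a compact subset of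
the interior misses `κ(∂W × [0, ε])` for small `ε`).

The definitions (with bodies) are the sets `modelTube`, `unitTube`, `closedUnitTube`,
`collarBelow`, `awaySet` (`K₀`), `tubeHat`, `handleHat`, `collarP`, `coneP` and the two model
homotopy equivalences; everything else is proved; no named facts.

## References

* M. Kervaire, J. Milnor, *Groups of homotopy spheres I*, Ann. of Math. 77 (1963), §5 and
  footnote pp. 528–529. [KervaireMilnorAnnals1963]
* A. Kosinski, *Differential Manifolds* (1993), Ch. X §1 (Prop. 1.1) and §3. [Kosinski1993]
* A. Hatcher, *Algebraic Topology* (2002), Thm. 3.2 and Cor. 2.14, §3.1 pp. 203–204.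
  [HatcherAT2002]
-/

noncomputable section

open scoped Manifold ContDiff Topology
open Set Function Filter CategoryTheory Limits Topology Metric
open Literature.AlgebraicTopology.SingularHomology

namespace Literature.Topology.FourManifolds

/-- Local notation: `𝔼 n` is the model Euclidean space `EuclideanSpace ℝ (Fin n)`. -/
local notation "𝔼 " n:arg => EuclideanSpace ℝ (Fin n)

/-- Local notation: `𝕊 n` is the unit sphere in `EuclideanSpace ℝ (Fin (n + 1))`. -/
local notation "𝕊 " n:arg => (Metric.sphere (0 : EuclideanSpace ℝ (Fin (n + 1))) 1)

namespace NullCobordism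

variable {m : ℕ}
variable {M : Type} [TopologicalSpace M] [ChartedSpace (EuclideanSpace ℝ (Fin (m + 1))) M]
  [IsManifold (𝓡 (m + 1)) ∞ M]
  (c : NullCobordism (m + 1) M) {ι : Type} [Unique ι] {k l : ℕ}
  (ν : FramedSphereFamily (𝓡∂ (m + 1 + 1)) c.W ι k (l + 1)) (hkl : k + l = m + 1)

/-! ### §1 The tubes -/

section Tubes

omit [IsManifold (𝓡 (m + 1)) ∞ M]

/-- The model open unit tube `Sᵏ × Bˡ⁺¹ ⊆ Sᵏ × ℝˡ⁺¹`. [folklore] -/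
def modelTube (k l : ℕ) : Set ((𝕊 k) × (𝔼 (l + 1))) := {q | ‖q.2‖ < 1}

/-- The model open unit tube is open. [folklore] -/
theorem isOpen_modelTube (k l : ℕ) : IsOpen (modelTube k l) :=
  isOpen_lt (continuous_norm.comp continuous_snd) continuous_const

/-- **The open unit tube `T = φ(Sᵏ × Bˡ⁺¹)` of the framed sphere** (Kervaire–Milnor 1963, §5).
[cite: KervaireMilnorAnnals1963, §5] -/
def unitTube : Set c.W := ν.toFun default '' modelTube k l

/-- The closed unit tube `φ(Sᵏ × D̄ˡ⁺¹)`. [cite: KervaireMilnorAnnals1963, §5] -/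
def closedUnitTube : Set c.W := ν.toFun default '' {q | ‖q.2‖ ≤ 1}

/-- The open unit tube is open. [folklore] -/
theorem isOpen_unitTube : IsOpen (c.unitTube ν) :=
  (ν.isOpenEmbedding_toFun default).isOpenMap _ (isOpen_modelTube k l)

/-- The closed unit tube is compact. [folklore] -/
theorem isCompact_closedUnitTube : IsCompact (c.closedUnitTube ν) := by
  have h : IsCompact ({q : (𝕊 k) × (𝔼 (l + 1)) | ‖q.2‖ ≤ 1}) := by
    have : {q : (𝕊 k) × (𝔼 (l + 1)) | ‖q.2‖ ≤ 1} = univ ×ˢ Metric.closedBall (0 : 𝔼 (l + 1)) 1 := by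
      ext q; simp
    rw [this]
    exact isCompact_univ.prod (isCompact_closedBall _ _)
  exact h.image (ν.isOpenEmbedding_toFun default).continuous

/-- `T ⊆ T̄`. [folklore] -/
theorem unitTube_subset_closedUnitTube : c.unitTube ν ⊆ c.closedUnitTube ν := by
  rintro _ ⟨q, hq, rfl⟩; exact ⟨q, le_of_lt (show ‖q.2‖ < 1 from hq), rfl⟩

/-- The core sphere lies in the open unit tube. [folklore] -/
theorem cores_subset_unitTube : ν.cores ⊆ c.unitTube ν := by
  intro x hx
  obtain ⟨i, v, rfl⟩ := ν.mem_cores_iff.1 hx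
  obtain rfl : i = default := Subsingleton.elim _ _
  exact ⟨(v, 0), show ‖(0 : 𝔼 (l + 1))‖ < 1 by simp, rfl⟩

end Tubes

include hkl in
omit [IsManifold (𝓡 (m + 1)) ∞ M] in
/-- The closed unit tube lies in the interior of `W`. [folklore] -/
theorem closedUnitTube_subset_interior :
    c.closedUnitTube ν ⊆ (𝓡∂ (m + 1 + 1)).interior c.W := by
  rintro _ ⟨q, -, rfl⟩
  exact ν.isInteriorPoint_apply hkl default q

/-! ### §2 A thin collar of the boundary off the closed tube, and the compact set `K₀` -/

section Collar

variable (κ : c.boundaryData.Collar)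

/-- The closed collar `κ(∂W × [0, ε])` below level `ε`. [folklore] -/
def collarBelow (ε : ℝ) : Set c.W := κ '' {p | (p.2 : ℝ) ≤ ε}

/-- The closed collar below level `ε` is compact. [folklore] -/
theorem isCompact_collarBelow [CompactSpace M] (ε : ℝ) : IsCompact (c.collarBelow κ ε) := by
  haveI : CompactSpace (c.boundaryData.carrier × Set.Icc (0 : ℝ) 1) :=
    inferInstanceAs (CompactSpace (M × Set.Icc (0 : ℝ) 1))
  have hcl : IsClosed {p : c.boundaryData.carrier × Set.Icc (0 : ℝ) 1 | (p.2 : ℝ) ≤ ε} :=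
    isClosed_le (continuous_subtype_val.comp continuous_snd) continuous_const
  exact hcl.isCompact.image κ.continuous

/-- `C_ε ⊆ κ(∂W × [0, ε])`. [folklore] -/
theorem collarNhd_subset_collarBelow (ε : ℝ) : c.collarNhd κ ε ⊆ c.collarBelow κ ε := by
  rintro _ ⟨p, hp, rfl⟩; exact ⟨p, le_of_lt (show (p.2 : ℝ) < ε from hp), rfl⟩

/-- **A thin collar avoids any compact subset of the interior**: for `C ⊆ W ∖ ∂W` compact there
is `0 < ε ≤ 1` with `κ(∂W × [0, ε]) ∩ C = ∅` (the compact sets `κ(∂W × [0, 1/(n+1)]) ∩ C`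
decrease to `κ(∂W × {0}) ∩ C = ∂W ∩ C = ∅`). [folklore] -/
theorem exists_collarBelow_disjoint [CompactSpace M] [T2Space M] {C : Set c.W} (hC : IsCompact C)
    (hCint : C ⊆ (𝓡∂ (m + 1 + 1)).interior c.W) :
    ∃ ε : ℝ, 0 < ε ∧ ε ≤ 1 ∧ Disjoint (c.collarBelow κ ε) C := by
  set F : ℕ → Set c.W := fun n => c.collarBelow κ (1 / ((n : ℝ) + 1)) ∩ C with hF
  by_cases hne : ∀ n, (F n).Nonempty
  · exfalso
    have hanti : ∀ {a b : ℕ}, a ≤ b → F b ⊆ F a := by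
      intro a b hab x hx
      obtain ⟨⟨p, hp, rfl⟩, hxC⟩ := hx
      refine ⟨⟨p, le_trans (show (p.2 : ℝ) ≤ _ from hp) ?_, rfl⟩, hxC⟩
      exact one_div_le_one_div_of_le (by positivity) (by exact_mod_cast Nat.succ_le_succ hab)
    have hdir : Directed (· ⊇ ·) F := fun a b =>
      ⟨max a b, hanti (le_max_left a b), hanti (le_max_right a b)⟩
    have hcpt : ∀ n, IsCompact (F n) := fun n =>
      (c.isCompact_collarBelow κ _).inter_right hC.isClosed
    obtain ⟨x, hx⟩ := IsCompact.nonempty_iInter_of_directed_nonempty_isCompact_isClosed F hdir hne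
      hcpt fun n => (hcpt n).isClosed
    rw [mem_iInter] at hx
    obtain ⟨⟨p, hp0, rfl⟩, hpC⟩ := hx 0
    have hpos : 0 < (p.2 : ℝ) := c.collar_snd_pos_of_mem_interior κ (hCint hpC)
    obtain ⟨n, hn⟩ := exists_nat_one_div_lt hpos
    obtain ⟨⟨q, hq, hqp⟩, -⟩ := hx n
    have hqp' : q = p := κ.injective hqp
    subst hqp'
    exact absurd (lt_of_le_of_lt hq hn) (lt_irrefl _)
  · simp only [not_forall, Set.not_nonempty_iff_eq_empty] at hne
    obtain ⟨n, hn⟩ := hne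
    refine ⟨1 / ((n : ℝ) + 1), by positivity, ?_, ?_⟩
    · rw [div_le_one (by positivity)]; exact_mod_cast Nat.succ_le_succ (Nat.zero_le n)
    · rw [Set.disjoint_iff_inter_eq_empty]
      exact hn

/-- **The compact part `K₀` of the common piece** (as a subset of `W`): the points off the open
unit tube and off the collar neighbourhood `C_ε = κ(∂W × [0, ε))`.  [folklore] -/
def awaySet (ε : ℝ) : Set c.W := (c.unitTube ν ∪ c.collarNhd κ ε)ᶜ

/-- `K₀` is compact (`W` is compact and `K₀` is closed). [folklore] -/
theorem isCompact_awaySet [CompactSpace M] {ε : ℝ} (hε1 : ε ≤ 1) : IsCompact (c.awaySet ν κ ε) :=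
  ((c.isOpen_unitTube ν).union (c.isOpen_collarNhd κ hε1)).isClosed_compl.isCompact

/-- `K₀` misses the boundary. [folklore] -/
theorem awaySet_subset_interior {ε : ℝ} (hε : 0 < ε) :
    c.awaySet ν κ ε ⊆ (𝓡∂ (m + 1 + 1)).interior c.W := by
  intro x hx
  rw [← ModelWithCorners.compl_boundary]
  exact fun hb => hx (Or.inr (c.boundary_subset_collarNhd κ hε hb))

/-- `K₀` misses the core sphere. [folklore] -/
theorem awaySet_subset_complement (ε : ℝ) : c.awaySet ν κ ε ⊆ (ν.complement : Set c.W) :=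
  fun _ hx hc => hx (Or.inl (c.cores_subset_unitTube ν hc))

end Collar

/-! ### §3 Integral cohomology of spheres in degrees `≥ 2` -/

section SphereCohomology

/-- **`Hʲ(Sᴹ; ℤ) = 0` for `2 ≤ j ≠ M`** (Hatcher 2002, Cor. 2.14 with Thm. 3.2: the universal
coefficient theorem with `H_{j-1}(Sᴹ; ℤ)` free and `H_j(Sᴹ; ℤ) = 0`). [cite: HatcherAT2002, Thm. 3.2 and Cor. 2.14] -/
theorem isZero_singularCohomology_sphere_int {N j : ℕ} (hj : 2 ≤ j) (hjM : j ≠ N) :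
    IsZero (singularCohomology ℤ ℤ (𝕊 N) j) := by
  obtain ⟨j, rfl⟩ : ∃ j', j = j' + 1 := ⟨j - 1, by omega⟩
  -- `H_{j}(Sᴹ; ℤ)` is free
  haveI : Module.Free ℤ (singularHomology ℤ ℤ (𝕊 N) j) := by
    by_cases hjM' : j = N
    · subst hjM'
      obtain ⟨e⟩ := nonempty_singularHomology_sphere_iso_holds (R := ℤ) (M := ℤ) (n := j) (by omega)
      exact Module.Free.of_equiv (e.toLinearEquiv.trans (ULift.moduleEquiv (R := ℤ))).symm
    · haveI := ModuleCat.subsingleton_of_isZero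
        (isZero_singularHomology_sphere_holds (R := ℤ) (M := ℤ) (n := N) (k := j) (by omega) hjM')
      exact Module.Free.of_subsingleton ℤ _
  have hinj := (kroneckerPairing_bijective_of_free ℤ (𝕊 N) j).1
  haveI := ModuleCat.subsingleton_of_isZero
    (isZero_singularHomology_sphere_holds (R := ℤ) (M := ℤ) (n := N) (k := j + 1) (by omega) hjM)
  haveI : Subsingleton (singularCohomology ℤ ℤ (𝕊 N) (j + 1)) := ⟨fun a b => hinj
    (LinearMap.ext fun x => by rw [Subsingleton.elim x 0, map_zero, map_zero])⟩
  exact ModuleCat.isZero_of_subsingleton _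

/-- Cohomology vanishing transports along homotopy equivalences and homeomorphisms: if
`Y ≃ₜ Y'`, `Y' ≃ₕ Sᴺ` then `Hʲ(Y; ℤ) = 0` for `2 ≤ j ≠ N`. [cite: HatcherAT2002, Cor. 2.11 and Cor. 2.14] -/
theorem isZero_singularCohomology_of_homeomorph_homotopyEquiv_sphere {Y Y' : Type}
    [TopologicalSpace Y] [TopologicalSpace Y'] (e : Y ≃ₜ Y')
    {N : ℕ} (h : ContinuousMap.HomotopyEquiv Y' (𝕊 N)) {j : ℕ} (hj : 2 ≤ j) (hjN : j ≠ N) :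
    IsZero (singularCohomology ℤ ℤ Y j) :=
  ((isZero_singularCohomology_sphere_int hj hjN).of_iso
    (singularCohomology.isoOfHomotopyEquiv' ℤ ℤ h j).symm).of_iso
      (singularCohomology.mapIso ℤ ℤ e j).symm

end SphereCohomology

/-! ### §4 The ends of `Ŵ`: the open tube and the cone neighbourhood -/

section EndsX

/-- **The model tube retracts onto its core sphere**: `Sᵏ × Bˡ⁺¹ ≃ₕ Sᵏ`. [folklore] -/
def modelTubeHomotopyEquiv (k l : ℕ) : ContinuousMap.HomotopyEquiv ↥(modelTube k l) (𝕊 k) where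
  toFun := ⟨fun q => q.1.1, continuous_fst.comp continuous_subtype_val⟩
  invFun := ⟨fun u => ⟨(u, 0), show ‖(0 : 𝔼 (l + 1))‖ < 1 by simp⟩,
    (Continuous.prodMk continuous_id continuous_const).subtype_mk _⟩
  left_inv :=
    ⟨{ toFun := fun p => ⟨(p.2.1.1, (p.1 : ℝ) • p.2.1.2), by
          show ‖(p.1 : ℝ) • p.2.1.2‖ < 1
          rw [norm_smul, Real.norm_eq_abs, abs_of_nonneg p.1.2.1]
          exact lt_of_le_of_lt (mul_le_of_le_one_left (norm_nonneg _) p.1.2.2) p.2.2⟩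
       continuous_toFun := by
          refine Continuous.subtype_mk (Continuous.prodMk ?_ ?_) _
          · exact continuous_fst.comp (continuous_subtype_val.comp continuous_snd)
          · exact (continuous_subtype_val.comp continuous_fst).smul
              (continuous_snd.comp (continuous_subtype_val.comp continuous_snd))
       map_zero_left := fun q => by
          apply Subtype.ext
          change (q.1.1, ((0 : unitInterval) : ℝ) • q.1.2) = (q.1.1, (0 : 𝔼 (l + 1)))
          simp
       map_one_left := fun q => by
          apply Subtype.ext
          change (q.1.1, ((1 : unitInterval) : ℝ) • q.1.2) = q.1
          simp }⟩
  right_inv := ContinuousMap.Homotopic.refl _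

variable (κ : c.boundaryData.Collar)

/-- **The open tube of the closed model** `T̂ = q(T) ⊆ Ŵ`. [cite: KervaireMilnorAnnals1963, §5] -/
def tubeHat : Set (ClosedModel (m + 1) c.W) := boundaryCollapse (m + 1) c.W '' c.unitTube ν

omit [IsManifold (𝓡 (m + 1)) ∞ M] in
/-- An image under the collapse of a subset of the interior, in terms of `ofInterior`. [folklore] -/
theorem image_boundaryCollapse_eq_image_ofInterior {V : Set c.W}
    (hV : V ⊆ (𝓡∂ (m + 1 + 1)).interior c.W) :
    boundaryCollapse (m + 1) c.W '' V =
      (ClosedModel.ofInterior : ManifoldInterior (m + 1) c.W → _) '' {x | x.1 ∈ V} := by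
  ext y; constructor
  · rintro ⟨z, hz, rfl⟩
    exact ⟨⟨z, hV hz⟩, hz, (boundaryCollapse_of_mem_interior (hV hz)).symm⟩
  · rintro ⟨x, hx, rfl⟩
    exact ⟨x.1, hx, boundaryCollapse_of_mem_interior x.2⟩

include hkl in
omit [IsManifold (𝓡 (m + 1)) ∞ M] in
/-- The open tube of the closed model is open. [folklore] -/
theorem isOpen_tubeHat : IsOpen (c.tubeHat ν) := by
  rw [tubeHat, c.image_boundaryCollapse_eq_image_ofInterior
    ((c.unitTube_subset_closedUnitTube ν).trans (c.closedUnitTube_subset_interior ν hkl))]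
  exact ClosedModel.isOpen_image_coe_of_isOpen (c.isOpen_unitTube ν)

omit [IsManifold (𝓡 (m + 1)) ∞ M] in
/-- Membership of an interior point in the image of a subset of the interior under the collapse.
[folklore] -/
theorem ofInterior_mem_image_boundaryCollapse_iff {V : Set c.W}
    (hV : V ⊆ (𝓡∂ (m + 1 + 1)).interior c.W) (x : ManifoldInterior (m + 1) c.W) :
    ClosedModel.ofInterior x ∈ boundaryCollapse (m + 1) c.W '' V ↔ x.1 ∈ V := by
  constructor
  · rintro ⟨z, hz, hzx⟩
    rw [boundaryCollapse_of_mem_interior (hV hz)] at hzx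
    have h := OnePoint.coe_injective hzx
    rw [← h]; exact hz
  · intro hx
    exact ⟨x.1, hx, boundaryCollapse_of_mem_interior x.2⟩

omit [IsManifold (𝓡 (m + 1)) ∞ M] in
/-- `∞` is not in the image of a subset of the interior under the collapse. [folklore] -/
theorem infty_not_mem_image_boundaryCollapse {V : Set c.W}
    (hV : V ⊆ (𝓡∂ (m + 1 + 1)).interior c.W) :
    (ClosedModel.infty : ClosedModel (m + 1) c.W) ∉ boundaryCollapse (m + 1) c.W '' V := by
  rintro ⟨z, hz, hzq⟩
  rw [boundaryCollapse_of_mem_interior (hV hz)] at hzq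
  exact OnePoint.coe_ne_infty _ hzq

include hkl in
/-- **The complement of `q(K₀)` in `Ŵ` is `T̂ ∪ N_ε`.** [cite: KervaireMilnorAnnals1963, §7, footnote pp. 528–529] -/
theorem compl_image_boundaryCollapse_awaySet {ε : ℝ} (hε : 0 < ε) :
    (boundaryCollapse (m + 1) c.W '' c.awaySet ν κ ε)ᶜ = c.tubeHat ν ∪ c.coneNhd κ ε := by
  have hTint := (c.unitTube_subset_closedUnitTube ν).trans (c.closedUnitTube_subset_interior ν hkl)
  have hAint := c.awaySet_subset_interior ν κ hε
  ext y
  induction y using OnePoint.rec with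
  | infty =>
    constructor
    · intro _; exact Or.inr (c.infty_mem_coneNhd κ ε)
    · intro _; exact c.infty_not_mem_image_boundaryCollapse hAint
  | coe x =>
    constructor
    · intro hx
      have hx' : x.1 ∉ c.awaySet ν κ ε := fun h =>
        hx ((c.ofInterior_mem_image_boundaryCollapse_iff hAint x).2 h)
      have hx'' : x.1 ∈ c.unitTube ν ∪ c.collarNhd κ ε := not_not.1 hx'
      rcases hx'' with hT | hN
      · exact Or.inl ((c.ofInterior_mem_image_boundaryCollapse_iff hTint x).2 hT)
      · exact Or.inr ((c.ofInterior_mem_coneNhd_iff κ x).2 hN)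
    · rintro (hT | hN) hA
      · exact (c.ofInterior_mem_image_boundaryCollapse_iff hAint x).1 hA
          (Or.inl ((c.ofInterior_mem_image_boundaryCollapse_iff hTint x).1 hT))
      · exact (c.ofInterior_mem_image_boundaryCollapse_iff hAint x).1 hA
          (Or.inr ((c.ofInterior_mem_coneNhd_iff κ x).1 hN))

include hkl in
/-- For a thin collar (missing the closed tube) the two ends of `Ŵ` are disjoint. [folklore] -/
theorem tubeHat_inter_coneNhd_eq_empty {ε : ℝ}
    (hdis : Disjoint (c.collarBelow κ ε) (c.closedUnitTube ν)) :
    c.tubeHat ν ∩ c.coneNhd κ ε = ∅ := by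
  have hTint := (c.unitTube_subset_closedUnitTube ν).trans (c.closedUnitTube_subset_interior ν hkl)
  ext y
  simp only [mem_inter_iff, mem_empty_iff_false, iff_false, not_and]
  intro hyT hyN
  induction y using OnePoint.rec with
  | infty => exact c.infty_not_mem_image_boundaryCollapse hTint hyT
  | coe x =>
    have hxT : x.1 ∈ c.unitTube ν := (c.ofInterior_mem_image_boundaryCollapse_iff hTint x).1 hyT
    have hxN : x.1 ∈ c.collarNhd κ ε := (c.ofInterior_mem_coneNhd_iff κ x).1 hyN
    exact Set.disjoint_left.1 hdis (c.collarNhd_subset_collarBelow κ ε hxN)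
      (c.unitTube_subset_closedUnitTube ν hxT)

include hkl in
omit [IsManifold (𝓡 (m + 1)) ∞ M] in
/-- **The open tube of the closed model is the model tube**: `T̂ ≅ Sᵏ × Bˡ⁺¹`. [cite: KervaireMilnorAnnals1963, §5] -/
theorem nonempty_tubeHat_homeomorph : Nonempty (↥(c.tubeHat ν) ≃ₜ ↥(modelTube k l)) := by
  have hTint := (c.unitTube_subset_closedUnitTube ν).trans (c.closedUnitTube_subset_interior ν hkl)
  -- the open embedding `Sᵏ × Bˡ⁺¹ → Ŵ`
  let h' : ↥(modelTube k l) → ManifoldInterior (m + 1) c.W := fun q =>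
    ⟨ν.toFun default q, ν.isInteriorPoint_apply hkl default q⟩
  have hval : IsOpenEmbedding (Subtype.val : ManifoldInterior (m + 1) c.W → c.W) :=
    ((𝓡∂ (m + 1 + 1)).isOpen_interior (M := c.W) one_ne_zero).isOpenEmbedding_subtypeVal
  have hh' : IsOpenEmbedding h' :=
    (IsOpenEmbedding.of_comp_iff h' hval).1
      ((ν.isOpenEmbedding_toFun default).comp (isOpen_modelTube k l).isOpenEmbedding_subtypeVal)
  have hg : IsOpenEmbedding (ClosedModel.ofInterior ∘ h') := OnePoint.isOpenEmbedding_coe.comp hh'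
  have hrange : range (ClosedModel.ofInterior ∘ h') = c.tubeHat ν := by
    rw [tubeHat, c.image_boundaryCollapse_eq_image_ofInterior hTint, range_comp]
    congr 1
    ext x; constructor
    · rintro ⟨q, rfl⟩; exact ⟨q, q.2, rfl⟩
    · rintro ⟨q, hq, hqx⟩; exact ⟨⟨q, hq⟩, Subtype.ext hqx⟩
  exact ⟨(hg.isEmbedding.toHomeomorph.trans (Homeomorph.setCongr hrange)).symm⟩

include hkl in
omit [IsManifold (𝓡 (m + 1)) ∞ M] in
/-- **`Hʲ(T̂; ℤ) = 0` for `2 ≤ j ≠ k`** (`T̂ ≃ Sᵏ`). [cite: KervaireMilnorAnnals1963, §5 (Lemma 5.2)] -/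
theorem isZero_singularCohomology_tubeHat {j : ℕ} (hj : 2 ≤ j) (hjk : j ≠ k) :
    IsZero (singularCohomology ℤ ℤ ↥(c.tubeHat ν) j) := by
  obtain ⟨e⟩ := c.nonempty_tubeHat_homeomorph ν hkl
  exact isZero_singularCohomology_of_homeomorph_homotopyEquiv_sphere e (modelTubeHomotopyEquiv k l)
    hj hjk

/-- **`Hʲ(N_ε; ℤ) = 0` for `j ≠ 0`** (the cone neighbourhood is contractible,
`contractibleSpace_coneNhd`). [cite: HatcherAT2002, §3.1 pp. 203–204] -/
theorem isZero_singularCohomology_coneNhd' [Nonempty M] [CompactSpace M] {ε : ℝ} (hε1 : ε ≤ 1)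
    {j : ℕ} (hj : j ≠ 0) : IsZero (singularCohomology ℤ ℤ ↥(c.coneNhd κ ε) j) := by
  haveI := c.contractibleSpace_coneNhd κ hε1
  exact Literature.AlgebraicTopology.SingularHomology.isZero_singularCohomology_of_contractibleSpace
    ℤ ℤ _ hj

end EndsX

/-! ### §5 The ends of `χ̂`: the open handle and the cone neighbourhood -/

section EndsP

/-- **The model handle retracts onto its cocore sphere**: `Bᵏ⁺¹ × Sˡ ≃ₕ Sˡ`. [folklore] -/
def ballProdSphereHomotopyEquiv (k l : ℕ) :
    ContinuousMap.HomotopyEquiv (↥(Metric.ball (0 : 𝔼 (k + 1)) 1) × (𝕊 l)) (𝕊 l) where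
  toFun := ⟨fun p => p.2, continuous_snd⟩
  invFun := ⟨fun u => (⟨0, by simp⟩, u), (Continuous.prodMk continuous_const continuous_id)⟩
  left_inv :=
    ⟨{ toFun := fun p => (⟨(p.1 : ℝ) • (p.2.1 : 𝔼 (k + 1)), by
          rw [mem_ball_zero_iff, norm_smul, Real.norm_eq_abs, abs_of_nonneg p.1.2.1]
          exact lt_of_le_of_lt (mul_le_of_le_one_left (norm_nonneg _) p.1.2.2)
            (mem_ball_zero_iff.1 p.2.1.2)⟩, p.2.2)
       continuous_toFun := by
          refine Continuous.prodMk (Continuous.subtype_mk ?_ _) (continuous_snd.comp continuous_snd)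
          exact (continuous_subtype_val.comp continuous_fst).smul
            (continuous_subtype_val.comp (continuous_fst.comp continuous_snd))
       map_zero_left := fun p => by
          apply Prod.ext
          · apply Subtype.ext
            change ((0 : unitInterval) : ℝ) • (p.1 : 𝔼 (k + 1)) = 0
            simp
          · rfl
       map_one_left := fun p => by
          apply Prod.ext
          · apply Subtype.ext
            change ((1 : unitInterval) : ℝ) • (p.1 : 𝔼 (k + 1)) = p.1
            simp
          · rfl }⟩
  right_inv := ContinuousMap.Homotopic.refl _

variable (κ : c.boundaryData.Collar)

/-- **The open handle of the closed model of `χ`**: `T̂' = q'(OD^{k+1} × Sˡ) ⊆ χ̂`.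
[cite: KervaireMilnorAnnals1963, §5] -/
def handleHat : Set (ClosedModel (m + 1) (c.surgery ν hkl).W) :=
  boundaryCollapse (m + 1) (c.surgery ν hkl).W '' range (c.surgeryHandleMap ν hkl)

/-- The thin collar of `χ`: the image under `inl` of the collar neighbourhood `C_ε` of `∂W`
(surgery in the interior does not touch a neighbourhood of the boundary). [cite: Kosinski1993, Ch. X §2, p. 201] -/
def collarP (ε : ℝ) : Set (c.surgery ν hkl).W :=
  (c.surgeryPiece ν hkl).j '' {a | (a : c.W) ∈ c.collarNhd κ ε}

/-- **The cone neighbourhood of `∞` in `χ̂` over the thin collar**: `N'_ε = {∞} ∪ (inl C_ε)°`.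
[cite: KervaireMilnorAnnals1963, §7, footnote pp. 528–529] -/
def coneP (ε : ℝ) : Set (ClosedModel (m + 1) (c.surgery ν hkl).W) :=
  insert ClosedModel.infty ((ClosedModel.ofInterior : ManifoldInterior (m + 1) (c.surgery ν hkl).W → _) ''
    {x | x.1 ∈ c.collarP ν hkl κ ε})

omit [IsManifold (𝓡 (m + 1)) ∞ M] in
/-- The gluing maps of the surgered manifold (topological content of
`isOpenGluingWith_surgered`; private copy). [cite: MilnorHCobordism1965, Def. 3.11 (PDF p. 17)] -/
private theorem surgered_gluing₃ :
    IsOpenEmbedding (ν.glueData hkl).inl ∧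
      IsOpenEmbedding ((ν.glueData hkl).inr ∘ SphereSurgery.toHandle ι k l hkl) ∧
      range (ν.glueData hkl).inl ∪ range ((ν.glueData hkl).inr ∘ SphereSurgery.toHandle ι k l hkl) =
        univ ∧
      ∀ a b, (ν.glueData hkl).inl a = ((ν.glueData hkl).inr ∘ SphereSurgery.toHandle ι k l hkl) b ↔
        sphereFamilySurgeryRel ν a b := by
  have h := ν.isOpenGluingWith_surgered hkl
  exact ⟨⟨h.1.isEmbedding, h.2.1⟩, ⟨h.2.2.1.isEmbedding, h.2.2.2.1⟩, h.2.2.2.2.1, h.2.2.2.2.2⟩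

omit [IsManifold (𝓡 (m + 1)) ∞ M] in
/-- A point of `W ∖ S` in the open unit tube lies in the glued part (the punctured tube).
[folklore] -/
theorem mem_gluedPart_of_mem_unitTube {a : ↥ν.complement} (ha : (a : c.W) ∈ c.unitTube ν) :
    a ∈ ν.gluedPart := by
  obtain ⟨q, hq, hqa⟩ := ha
  refine ⟨q, ⟨?_, hq⟩, hqa⟩
  intro hq0
  apply a.2
  rw [← hqa]
  exact ν.mem_cores_iff.2 ⟨default, q.1, by rw [FramedSphereFamily.sphere_apply, ← hq0]⟩

omit [IsManifold (𝓡 (m + 1)) ∞ M] in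
/-- Points of the glued part lie in the open unit tube. [folklore] -/
theorem mem_unitTube_of_mem_gluedPart {a : ↥ν.complement} (ha : a ∈ ν.gluedPart) :
    (a : c.W) ∈ c.unitTube ν := by
  obtain ⟨q, hq, hqa⟩ := ha
  exact ⟨q, hq.2, hqa⟩

/-- Membership of an interior point of `χ` in the image of a subset of the interior under the
collapse. [folklore] -/
theorem ofInterior_mem_image_boundaryCollapse_iff_P {V : Set (c.surgery ν hkl).W}
    (hV : V ⊆ (𝓡∂ (m + 1 + 1)).interior (c.surgery ν hkl).W)
    (x : ManifoldInterior (m + 1) (c.surgery ν hkl).W) :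
    ClosedModel.ofInterior x ∈ boundaryCollapse (m + 1) (c.surgery ν hkl).W '' V ↔ x.1 ∈ V := by
  constructor
  · rintro ⟨z, hz, hzx⟩
    rw [boundaryCollapse_of_mem_interior (hV hz)] at hzx
    have h := OnePoint.coe_injective hzx
    rw [← h]; exact hz
  · intro hx
    exact ⟨x.1, hx, boundaryCollapse_of_mem_interior x.2⟩

/-- The range of the handle lies in the interior of `χ`. [folklore] -/
theorem range_surgeryHandleMap_subset_interior :
    range (c.surgeryHandleMap ν hkl) ⊆ (𝓡∂ (m + 1 + 1)).interior (c.surgery ν hkl).W := by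
  rintro _ ⟨b, rfl⟩; exact c.surgeryHandleMap_mem_interior ν hkl b

/-- **The complement of `q'(inl K₀)` in `χ̂` is `T̂' ∪ N'_ε`.** [cite: KervaireMilnorAnnals1963, §7, footnote pp. 528–529] -/
theorem compl_image_boundaryCollapse_awaySet_P {ε : ℝ} (hε : 0 < ε) :
    (boundaryCollapse (m + 1) (c.surgery ν hkl).W ''
      ((c.surgeryPiece ν hkl).j '' {a | (a : c.W) ∈ c.awaySet ν κ ε}))ᶜ =
      c.handleHat ν hkl ∪ c.coneP ν hkl κ ε := by
  obtain ⟨hA, -, hcov, hrel⟩ := surgered_gluing₃ c ν hkl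
  set S := c.surgeryPiece ν hkl with hS
  have hAint : S.j '' {a | (a : c.W) ∈ c.awaySet ν κ ε} ⊆
      (𝓡∂ (m + 1 + 1)).interior (c.surgery ν hkl).W := by
    rintro _ ⟨a, ha, rfl⟩
    exact S.j_mem_interior (c.awaySet_subset_interior ν κ hε ha)
  have hHint := c.range_surgeryHandleMap_subset_interior ν hkl
  ext y
  induction y using OnePoint.rec with
  | infty =>
    constructor
    · intro _; exact Or.inr (mem_insert _ _)
    · intro _
      rintro ⟨z, hz, hzq⟩
      rw [boundaryCollapse_of_mem_interior (hAint hz)] at hzq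
      exact OnePoint.coe_ne_infty _ hzq
  | coe x =>
    have hxcov : x.1 ∈ range S.j ∨ x.1 ∈ range (c.surgeryHandleMap ν hkl) := by
      have : x.1 ∈ range (ν.glueData hkl).inl ∪
          range ((ν.glueData hkl).inr ∘ SphereSurgery.toHandle ι k l hkl) := by
        rw [hcov]; exact mem_univ _
      exact this
    constructor
    · intro hx
      rcases hxcov with ⟨a, ha⟩ | hH
      · have ha' : (a : c.W) ∉ c.awaySet ν κ ε := fun h =>
          hx ((c.ofInterior_mem_image_boundaryCollapse_iff_P ν hkl hAint x).2 ⟨a, h, ha⟩)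
        have ha'' : (a : c.W) ∈ c.unitTube ν ∪ c.collarNhd κ ε := not_not.1 ha'
        rcases ha'' with hT | hN
        · -- in the punctured tube, hence in the handle
          have hglued := c.mem_gluedPart_of_mem_unitTube ν hT
          have hxH : x.1 ∈ range (c.surgeryHandleMap ν hkl) := by
            rw [← ha]; exact FramedSphereFamily.apply_mem_range_jB hrel hglued
          exact Or.inl ((c.ofInterior_mem_image_boundaryCollapse_iff_P ν hkl hHint x).2 hxH)
        · refine Or.inr (mem_insert_of_mem _ ⟨x, ?_, rfl⟩)
          exact ⟨a, hN, ha⟩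
      · exact Or.inl ((c.ofInterior_mem_image_boundaryCollapse_iff_P ν hkl hHint x).2 hH)
    · rintro (hT | hN) hxA
      · have hxH : x.1 ∈ range (c.surgeryHandleMap ν hkl) :=
          (c.ofInterior_mem_image_boundaryCollapse_iff_P ν hkl hHint x).1 hT
        obtain ⟨a, ha, hax⟩ := (c.ofInterior_mem_image_boundaryCollapse_iff_P ν hkl hAint x).1 hxA
        have hmem : x.1 ∈ range S.j ∩ range (c.surgeryHandleMap ν hkl) := ⟨⟨a, hax⟩, hxH⟩
        have hmem' : x.1 ∈ range (ν.glueData hkl).inl ∩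
            range ((ν.glueData hkl).inr ∘ SphereSurgery.toHandle ι k l hkl) := hmem
        rw [FramedSphereFamily.range_inter_range_eq hrel] at hmem'
        obtain ⟨a', ha', ha'x⟩ := hmem'
        have haa' : a' = a := S.j_injective (ha'x.trans hax.symm)
        subst haa'
        exact ha (Or.inl (c.mem_unitTube_of_mem_gluedPart ν ha'))
      · rcases (mem_insert_iff).1 hN with h | ⟨x', hx', hx'x⟩
        · exact OnePoint.coe_ne_infty _ h
        · have hxx : x' = x := OnePoint.coe_injective hx'x
          subst hxx
          obtain ⟨a, ha, hax⟩ := hx'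
          obtain ⟨a'', ha'', ha''x⟩ :=
            (c.ofInterior_mem_image_boundaryCollapse_iff_P ν hkl hAint x').1 hxA
          have : a'' = a := S.j_injective (ha''x.trans hax.symm)
          subst this
          exact ha'' (Or.inr ha)

/-- For a thin collar (missing the closed tube) the two ends of `χ̂` are disjoint. [folklore] -/
theorem handleHat_inter_coneP_eq_empty {ε : ℝ}
    (hdis : Disjoint (c.collarBelow κ ε) (c.closedUnitTube ν)) :
    c.handleHat ν hkl ∩ c.coneP ν hkl κ ε = ∅ := by
  obtain ⟨-, -, -, hrel⟩ := surgered_gluing₃ c ν hkl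
  have hHint := c.range_surgeryHandleMap_subset_interior ν hkl
  ext y
  simp only [mem_inter_iff, mem_empty_iff_false, iff_false, not_and]
  intro hyT hyN
  induction y using OnePoint.rec with
  | infty =>
    obtain ⟨z, hz, hzq⟩ := hyT
    rw [boundaryCollapse_of_mem_interior (hHint hz)] at hzq
    exact OnePoint.coe_ne_infty _ hzq
  | coe x =>
    have hxH : x.1 ∈ range (c.surgeryHandleMap ν hkl) :=
      (c.ofInterior_mem_image_boundaryCollapse_iff_P ν hkl hHint x).1 hyT
    rcases (mem_insert_iff).1 hyN with h | ⟨x', hx', hx'x⟩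
    · exact OnePoint.coe_ne_infty _ h
    · have hxx : x' = x := OnePoint.coe_injective hx'x
      subst hxx
      obtain ⟨a, ha, hax⟩ := hx'
      have hmem' : x'.1 ∈ range (ν.glueData hkl).inl ∩
          range ((ν.glueData hkl).inr ∘ SphereSurgery.toHandle ι k l hkl) := ⟨⟨a, hax⟩, hxH⟩
      rw [FramedSphereFamily.range_inter_range_eq hrel] at hmem'
      obtain ⟨a', ha', ha'x⟩ := hmem'
      have haa' : a' = a := (c.surgeryPiece ν hkl).j_injective (ha'x.trans hax.symm)
      subst haa'
      exact Set.disjoint_left.1 hdis (c.collarNhd_subset_collarBelow κ ε ha)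
        ((c.unitTube_subset_closedUnitTube ν) (c.mem_unitTube_of_mem_gluedPart ν ha'))

/-- The open handle of the closed model is open. [folklore] -/
theorem isOpen_handleHat : IsOpen (c.handleHat ν hkl) := by
  obtain ⟨-, hB, -, -⟩ := surgered_gluing₃ c ν hkl
  have hHint := c.range_surgeryHandleMap_subset_interior ν hkl
  have heq : c.handleHat ν hkl = (ClosedModel.ofInterior : ManifoldInterior (m + 1) (c.surgery ν hkl).W → _) ''
      {x | x.1 ∈ range (c.surgeryHandleMap ν hkl)} := by
    ext y; constructor
    · rintro ⟨z, hz, rfl⟩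
      exact ⟨⟨z, hHint hz⟩, hz, (boundaryCollapse_of_mem_interior (hHint hz)).symm⟩
    · rintro ⟨x, hx, rfl⟩
      exact ⟨x.1, hx, boundaryCollapse_of_mem_interior x.2⟩
  rw [heq]
  exact ClosedModel.isOpen_image_coe_of_isOpen hB.isOpen_range

/-- The cone neighbourhood `N'_ε` of `∞` in `χ̂` is open (`0 < ε ≤ 1`). [folklore] -/
theorem isOpen_coneP {ε : ℝ} (hε : 0 < ε) (hε1 : ε ≤ 1) : IsOpen (c.coneP ν hkl κ ε) := by
  refine ClosedModel.isOpen_hat_of_isOpen ?_ ?_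
  · exact (c.surgeryPiece ν hkl).isOpenEmbedding_j.isOpenMap _
      ((c.isOpen_collarNhd κ hε1).preimage continuous_subtype_val)
  · intro z hz
    rw [← ModelWithCorners.compl_boundary]
    intro hzb
    apply hz
    -- boundary points of `χ` are `inl` of boundary points of `W`, which lie in `C_ε`
    have hzb' : z ∈ (𝓡∂ (m + 1 + 1)).boundary (ν.Surgered hkl) := hzb
    rw [ν.boundary_surgered_eq hkl] at hzb'
    obtain ⟨a, ha, rfl⟩ := hzb'
    exact ⟨a, c.boundary_subset_collarNhd κ hε ha, rfl⟩

/-- **The open handle of the closed model is the model handle**: `T̂' ≅ Bᵏ⁺¹ × Sˡ`.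
[cite: KervaireMilnorAnnals1963, §5] -/
theorem nonempty_handleHat_homeomorph :
    Nonempty (↥(c.handleHat ν hkl) ≃ₜ (↥(Metric.ball (0 : 𝔼 (k + 1)) 1) × (𝕊 l))) := by
  obtain ⟨-, hB, -, -⟩ := surgered_gluing₃ c ν hkl
  have hHint := c.range_surgeryHandleMap_subset_interior ν hkl
  let h' : ↥(ballTimesSphere ι k l) → ManifoldInterior (m + 1) (c.surgery ν hkl).W := fun b =>
    ⟨c.surgeryHandleMap ν hkl b, c.surgeryHandleMap_mem_interior ν hkl b⟩
  have hval : IsOpenEmbedding (Subtype.val : ManifoldInterior (m + 1) (c.surgery ν hkl).W →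
      (c.surgery ν hkl).W) :=
    ((𝓡∂ (m + 1 + 1)).isOpen_interior (M := (c.surgery ν hkl).W) one_ne_zero).isOpenEmbedding_subtypeVal
  have hh' : IsOpenEmbedding h' := (IsOpenEmbedding.of_comp_iff h' hval).1 hB
  have hg : IsOpenEmbedding (ClosedModel.ofInterior ∘ h') := OnePoint.isOpenEmbedding_coe.comp hh'
  have hrange : range (ClosedModel.ofInterior ∘ h') = c.handleHat ν hkl := by
    ext y; constructor
    · rintro ⟨b, rfl⟩
      exact ⟨c.surgeryHandleMap ν hkl b, mem_range_self b,
        boundaryCollapse_of_mem_interior (c.surgeryHandleMap_mem_interior ν hkl b)⟩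
    · rintro ⟨_, ⟨b, rfl⟩, hby⟩
      exact ⟨b, (boundaryCollapse_of_mem_interior (c.surgeryHandleMap_mem_interior ν hkl b)).symm.trans hby⟩
  exact ⟨((hg.isEmbedding.toHomeomorph.trans (Homeomorph.setCongr hrange)).symm).trans
    (FramedSphereFamily.ballTimesSphereHomeomorph ι k l)⟩

/-- **`Hʲ(T̂'; ℤ) = 0` for `2 ≤ j ≠ l`** (`T̂' ≃ Sˡ`). [cite: KervaireMilnorAnnals1963, §5 (Lemma 5.2)] -/
theorem isZero_singularCohomology_handleHat {j : ℕ} (hj : 2 ≤ j) (hjl : j ≠ l) :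
    IsZero (singularCohomology ℤ ℤ ↥(c.handleHat ν hkl) j) := by
  obtain ⟨e⟩ := c.nonempty_handleHat_homeomorph ν hkl
  exact isZero_singularCohomology_of_homeomorph_homotopyEquiv_sphere e (ballProdSphereHomotopyEquiv k l)
    hj hjl

end EndsP

end NullCobordism

end Literature.Topology.FourManifolds
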